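import Literature.NumberTheory.Sieve.HeathBrownMorozClassUpperBounds
import HarnessLib

/-!
# Heath-Brown–Moroz 2004, Lemma 3.3 (= Heath-Brown's Lemma 3.7 for the class family), II: `U₂^(1)` and `U`

Sequel of `HeathBrownMorozClassUpperBounds`. D. R. Heath-Brown and B. Z. Moroz, Proc. LMS (3) 88 (2004)
289–312 [HeathBrownMoroz2004], Lemma 3.3 (p. 18 of the render) = [HeathBrownActa2001, Lemma 3.7] for the
class sequence: the approximation errors `|U − Û|` of the Type II pieces `U^(n)` (`n ≥ 3`), `U₁^(1)`,
`U₁^(2)`, `S₄`, `U₂^(1)` are `≪ ξτ^{-4}η²X²/log X`. As explained in part I, the tree's generic family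
inequalities make the `𝒜`-side bounds hold for EVERY subfamily `E' ⊆ 𝒜^(K)` with the constants of the
full family. Contents:

* `U2_sub_bound` — the `U₂^(1)`-line (tree template `U2_A_bound`);
* `U_sub_sum_bound` — the `U`-lines summed over `n` (template `U_A_sum_bound`); the split into the three
  `U`-lines and the assembly of HBM Lemma 3.3 are in part III (`HeathBrownMorozClassApproxAssembly`).

## References

* [HeathBrownMoroz2004] §3, Lemma 3.3, pp. 18–19. [cite: HeathBrownMoroz2004, Lemma 3.3]
* [HeathBrownActa2001] D. R. Heath-Brown, Acta Math. 186 (2001), Lemma 3.7, §7 pp. 41–47.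
  [cite: HeathBrownActa2001, Lemma 3.7]

## Mathlib / tree search

Tree: `U2_bound_of_h7`, `eventually_U2_params`, `rpow_tau_bounds`, `sqDefect_A_le`, `sqDefect_A_absorb`,
`one_le_eta_mul` (`HeathBrownCubicApproxU2Bounds`), `U_sum_bound`, `Upiece_eq_U1piece` (`…ApproxUSum`),
`E1_A_eq_zero`, `E3ii_A_eq_zero`, `E4_A_le`, `A_final_absorb`, `eventually_hbTau_pow_mul_log` (`…ApproxUA`),
`absNorm_pairIdeal_bounds`, `hbXi_div_pow_four`, `absorb_le`, `rpow_two_sub` (`…ApproxS4`),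
`famCount_boxPairs`, `countA_eq_zero_of_absNorm_eq`, `countA_eq_zero_of_not_prime`, `ten_le_log`,
`exists_sum_normWt_window_le`, `eventually_upperBound_params` (`…UpperBoundTools`),
`h7_of_subfamily`, `famCount_sub_eq_zero`, `famCount_mono`, `S4_sub_bound` (part I).
-/

noncomputable section

open Polynomial NumberField Finset Filter Topology Asymptotics
open scoped nonZeroDivisors

namespace Literature.NumberTheory.Sieve.CubicSieve

open LFunctions.CubeRootTwoField CubicPrimes
open Literature.NumberTheory.LFunctions (idealNormCount)

open scoped Classical in
/-- **Lemma 3.7, `U₂^(1)`-line, for every subfamily `E' ⊆ 𝒜^(K)`**: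
`|U₂^(1)(E') − Û₂^(1)(E')| ≤ C ξτ^{-4} η²X²/log X` for `X ≥ X₀`, `η` in (2.1) (template `U2_A_bound`; the
raw counts of `E'` are dominated by those of `𝒜^(K)`). [cite: HeathBrownMoroz2004, Lemma 3.3] -/
theorem U2_sub_bound {ϖ : ℝ} (hϖ0 : 0 < ϖ) (hϖ1 : ϖ < 1 / 5) :
    ∃ C X₀ : ℝ, ∀ X η : ℝ, X₀ ≤ X → Real.exp (-Real.log X ^ (1 / 3 : ℝ)) ≤ η → η ≤ 1 →
      ∀ E' : Finset (ℕ × ℕ), E' ⊆ boxPairs X η →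
      |(U2one E' pairIdeal X (hbTau ϖ X) : ℝ) - U2hat X (hbTau ϖ X) E' pairIdeal| ≤
        C * (hbXi (hbTau ϖ X) / hbTau ϖ X ^ 4) * (η ^ 2 * X ^ 2 / Real.log X) := by
  classical
  obtain ⟨C₇, X₇, h7⟩ := HeathBrown2001_lemma_7_1_normWeighted_holds ϖ hϖ0 hϖ1
  obtain ⟨C₁, hC₁, hwin⟩ := exists_sum_normWt_window_le
  have hϖ1' : ϖ ≤ 1 := by linarith
  set C₇' : ℝ := max C₇ 1 with hC₇'
  have hC₇'0 : 0 ≤ C₇' := le_trans zero_le_one (le_max_right _ _)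
  have hCC : C₇ ≤ C₇' := le_max_left _ _
  obtain ⟨X₁, hX₁⟩ := Filter.eventually_atTop.mp (eventually_U2_params hϖ0 hϖ1' hC₁ X₇)
  refine ⟨C₇' * (600 + 400 * C₁ + 8 * Real.log (2 * 24) + 225) + 72 * 180, X₁,
    fun X η hX hη hη1 E' hE' => ?_⟩
  obtain ⟨hX7, hX15, hτ0, hτ40, hLτ, hC₁τ, hτL, habs⟩ := hX₁ X hX
  set τ := hbTau ϖ X with hτdef
  have hX1 : 1 < X := lt_of_lt_of_le (by norm_num) hX15
  have hX0 : 0 < X := by linarith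
  have hXe : Real.exp 1 ≤ X := by
    have : Real.exp 1 ≤ (2 : ℝ) ^ 15 := by have := Real.exp_one_lt_d9; norm_num; linarith
    exact this.trans hX15
  set L := Real.log X with hL
  have hL10 : 10 ≤ L := ten_le_log hX15
  have hL1 : 1 ≤ L := by linarith
  have hη0 : 0 < η := lt_of_lt_of_le (Real.exp_pos _) hη
  obtain ⟨-, hXτ4, hCN⟩ := rpow_tau_bounds hX1 hτL
  have hE : ∀ xy ∈ E', pairIdeal xy ≠ ⊥ ∧ X ^ 3 < (Ideal.absNorm (pairIdeal xy) : ℝ) ∧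
      (Ideal.absNorm (pairIdeal xy) : ℝ) ≤ 24 * X ^ 3 := fun xy hxy =>
    ⟨pairIdeal_ne_bot_of_mem_boxPairs hX0.le xy (hE' hxy), absNorm_pairIdeal_bounds hX0 hη1 (hE' hxy)⟩
  have h7A := h7_of_subfamily hE' hX1 hτ0 hCC
    (fun N z 𝒬 hz hN hNX h𝒬 => (h7 X η hX7 hη hη1 N z 𝒬 hz hN hNX h𝒬).1)
  have hmain := U2_bound_of_h7 E' pairIdeal hC₁ hwin hX15 hτ0 hτ40 hXτ4 hLτ hC₁τ
    (by norm_num : (1 : ℝ) ≤ 24) hCN hE hC₇'0 (by positivity) (by positivity) h7A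
  -- the raw terms, dominated by those of `𝒜^(K)`
  have hT1 : ∑ t ∈ (Upairs X τ 1).filter (fun t => ¬ UGood t),
      (famCount E' pairIdeal (uIdeal t) : ℝ) = 0 := by
    refine sum_eq_zero fun t ht => ?_
    have h0 := E1_A_eq_zero X η τ 1
    have hle : (famCount E' pairIdeal (uIdeal t) : ℝ) ≤ famCount (boxPairs X η) pairIdeal (uIdeal t) := by
      exact_mod_cast famCount_mono pairIdeal hE' _
    have hterm : (famCount (boxPairs X η) pairIdeal (uIdeal t) : ℝ) ≤ 0 := by
      rw [← h0]
      exact single_le_sum (f := fun t => (famCount (boxPairs X η) pairIdeal (uIdeal t) : ℝ))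
        (fun _ _ => Nat.cast_nonneg _) ht
    have hnn : (0 : ℝ) ≤ famCount E' pairIdeal (uIdeal t) := Nat.cast_nonneg _
    linarith
  have hEq : ∑ x ∈ (primesNormIco (X ^ (1 / 2 : ℝ)) (24 * X ^ 3 + 1) ×ˢ
      primesNormIco (X ^ (1 / 2 : ℝ)) (24 * X ^ 3 + 1)).filter
      (fun x => x.1 ≠ x.2 ∧ Ideal.absNorm x.1 = Ideal.absNorm x.2),
      (famCount E' pairIdeal (x.1 * x.2) : ℝ) = 0 := by
    refine sum_eq_zero fun x hx => ?_
    rw [mem_filter, mem_product, mem_primesNormIco_iff, mem_primesNormIco_iff] at hx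
    obtain ⟨⟨⟨h1, h10, -⟩, ⟨h2, -, -⟩⟩, hne, hN⟩ := hx
    rw [famCount_sub_eq_zero hE'
      (countA_eq_zero_of_absNorm_eq h1 h10 h2 hne hN (dvd_mul_right _ _) (dvd_mul_left _ _)), Nat.cast_zero]
  have hDeg : ∑ Q ∈ (primesNormIco (X ^ (1 / 2 : ℝ)) (24 * X ^ 3 + 1)).filter
      (fun Q => ¬ (Ideal.absNorm Q).Prime), (famCount E' pairIdeal Q : ℝ) = 0 := by
    refine sum_eq_zero fun Q hQ => ?_
    rw [mem_filter, mem_primesNormIco_iff] at hQ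
    rw [famCount_sub_eq_zero hE' (countA_eq_zero_of_not_prime hQ.1.1 hQ.1.2.1 (dvd_refl Q) hQ.2),
      Nat.cast_zero]
  have habs2 : X ^ (-τ / 5) * L ^ 3 ≤ τ * η ^ 2 / L := by
    have hη2 : Real.exp (-2 * Real.log X ^ (1 / 3 : ℝ)) ≤ η ^ 2 := by
      have : Real.exp (-2 * Real.log X ^ (1 / 3 : ℝ)) = Real.exp (-Real.log X ^ (1 / 3 : ℝ)) ^ 2 := by
        rw [← Real.exp_nat_mul]; ring_nf
      rw [this]
      exact pow_le_pow_left₀ (Real.exp_pos _).le hη 2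
    refine habs.trans ?_
    exact div_le_div_of_nonneg_right (mul_le_mul_of_nonneg_left hη2 hτ0.le) (by linarith)
  have hSq : ∑ Q ∈ (primesNormIco (X ^ (1 / 2 : ℝ)) (X ^ (1 - τ))).filter
      (fun Q => (Ideal.absNorm Q).Prime), (famCount E' pairIdeal (Q * Q) : ℝ) ≤
      180 * (τ * η ^ 2 * X ^ 2 / L) := by
    have hmono : ∑ Q ∈ (primesNormIco (X ^ (1 / 2 : ℝ)) (X ^ (1 - τ))).filter
        (fun Q => (Ideal.absNorm Q).Prime), (famCount E' pairIdeal (Q * Q) : ℝ) ≤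
        ∑ Q ∈ (primesNormIco (X ^ (1 / 2 : ℝ)) (X ^ (1 - τ))).filter
          (fun Q => (Ideal.absNorm Q).Prime), (famCount (boxPairs X η) pairIdeal (Q * Q) : ℝ) :=
      sum_le_sum fun Q _ => by exact_mod_cast famCount_mono pairIdeal hE' _
    exact hmono.trans ((sqDefect_A_le hX15 hη0 hτ0 (by linarith) (X := X) (τ := τ)).trans
      (sqDefect_A_absorb hX1 hτ0 (by linarith) hη1 (one_le_eta_mul hXe hη) hL1 habs2))
  rw [hT1, hEq, hDeg, zero_add, zero_add, zero_add, ← hL] at hmain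
  have herr : 225 * L * (C₇' * X ^ (2 - τ / 5)) ≤ 225 * C₇' * (τ * η ^ 2 * X ^ 2 / L) := by
    have h := absorb_le (T := 225 * C₇') (δ := τ / 5) (j := 1) hX1.le hL1 (by positivity)
      le_rfl (by norm_num) habs2
    have e : X ^ (2 - τ / 5) = X ^ 2 * X ^ (-(τ / 5)) := rpow_two_sub hX0 (τ / 5)
    rw [pow_one] at h
    calc 225 * L * (C₇' * X ^ (2 - τ / 5)) = 225 * C₇' * (X ^ 2 * X ^ (-(τ / 5)) * L) := by rw [e]; ring
      _ ≤ _ := h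
  have hscale : hbXi τ / τ ^ 4 = τ := hbXi_div_pow_four hτ0.ne'
  rw [hscale]
  have hfinal : 72 * (180 * (τ * η ^ 2 * X ^ 2 / L)) +
      C₇' * (600 + 400 * C₁ + 8 * Real.log (2 * 24)) * (τ * (η ^ 2 * X ^ 2) / L) +
      225 * C₇' * (τ * η ^ 2 * X ^ 2 / L) =
      (C₇' * (600 + 400 * C₁ + 8 * Real.log (2 * 24) + 225) + 72 * 180) * τ * (η ^ 2 * X ^ 2 / L) := by ring
  calc _ ≤ 72 * ∑ Q ∈ (primesNormIco (X ^ (1 / 2 : ℝ)) (X ^ (1 - τ))).filter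
          (fun Q => (Ideal.absNorm Q).Prime), (famCount E' pairIdeal (Q * Q) : ℝ) +
        C₇' * (600 + 400 * C₁ + 8 * Real.log (2 * 24)) * (τ * (η ^ 2 * X ^ 2) / L) +
        225 * L * (C₇' * X ^ (2 - τ / 5)) := hmain
    _ ≤ 72 * (180 * (τ * η ^ 2 * X ^ 2 / L)) +
        C₇' * (600 + 400 * C₁ + 8 * Real.log (2 * 24)) * (τ * (η ^ 2 * X ^ 2) / L) +
        225 * C₇' * (τ * η ^ 2 * X ^ 2 / L) :=
        add_le_add (add_le_add (mul_le_mul_of_nonneg_left hSq (by norm_num)) le_rfl) herr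
    _ = _ := hfinal

set_option maxHeartbeats 400000 in
open scoped Classical in
/-- **Lemma 3.7, the `U`-lines summed over `n`, for every subfamily `E' ⊆ 𝒜^(K)`**:
`∑_{1 ≤ n ≤ n₀} |U₁^(n)(E') − Û^(n)(E')| ≤ C ξτ^{-4} η²X²/log X` (template `U_A_sum_bound`; the raw counts
E1, E3ii vanish and E4 is dominated by that of `𝒜^(K)`); also records `1 < X`, `0 < τ ≤ 1/40`.
[cite: HeathBrownMoroz2004, Lemma 3.3] -/
theorem U_sub_sum_bound {ϖ : ℝ} (hϖ0 : 0 < ϖ) (hϖ1 : ϖ < 1 / 5) :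
    ∃ C X₀ : ℝ, ∀ X η : ℝ, X₀ ≤ X → Real.exp (-Real.log X ^ (1 / 3 : ℝ)) ≤ η → η ≤ 1 →
      ∀ E' : Finset (ℕ × ℕ), E' ⊆ boxPairs X η →
      1 < X ∧ 0 < hbTau ϖ X ∧ hbTau ϖ X ≤ 1 / 40 ∧
      ∑ n ∈ Icc 1 (chainBound (hbTau ϖ X)),
          |(U1piece E' pairIdeal X (hbTau ϖ X) n : ℝ) - Uhat X (hbTau ϖ X) E' pairIdeal n| ≤
        C * (hbXi (hbTau ϖ X) / hbTau ϖ X ^ 4) * (η ^ 2 * X ^ 2 / Real.log X) := by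
  classical
  obtain ⟨C₇, X₇, h7⟩ := HeathBrown2001_lemma_7_1_normWeighted_holds ϖ hϖ0 hϖ1
  obtain ⟨C₁, hC₁, hwin⟩ := exists_sum_normWt_window_le
  have hϖ1' : ϖ ≤ 1 := by linarith
  set C₇' : ℝ := max C₇ 1 with hC₇'
  have hC₇'0 : 0 ≤ C₇' := le_trans zero_le_one (le_max_right _ _)
  have hCC : C₇ ≤ C₇' := le_max_left _ _
  have hcpos : 0 < min (1 / 40 : ℝ) (1 / (2 * C₁ + 1)) := lt_min (by norm_num) (by positivity)
  obtain ⟨X₁, hX₁⟩ := Filter.eventually_atTop.mp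
    ((eventually_upperBound_params hϖ0 hϖ1' one_pos 3).and
      ((eventually_le_hbTau_mul_log hϖ1' 4).and
        ((eventually_hbTau_pow_mul_log hϖ0 hϖ1' 5 12 hcpos).and
          (eventually_ge_atTop (max X₇ ((2 : ℝ) ^ 15))))))
  refine ⟨C₇' * (1600 + 700 * C₁) + 140 * C₇' + 120, X₁, fun X η hX hη hη1 E' hE' => ?_⟩
  obtain ⟨⟨-, hτ0, hτ8, hlogτ, habs⟩, hτL4, ⟨h12, hτc⟩, hXmax⟩ := hX₁ X hX
  set τ := hbTau ϖ X with hτdef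
  have hX15 : (2 : ℝ) ^ 15 ≤ X := le_trans (le_max_right _ _) hXmax
  have hX7 : X₇ ≤ X := le_trans (le_max_left _ _) hXmax
  have hX1 : 1 < X := lt_of_lt_of_le (by norm_num) hX15
  have hX0 : 0 < X := by linarith
  have hX24 : (24 : ℝ) ≤ X := le_trans (by norm_num) hX15
  set L := Real.log X with hL
  have hL10 : 10 ≤ L := ten_le_log hX15
  have hL1 : 1 ≤ L := by linarith
  have hL0 : 0 < L := by linarith
  have hη0 : 0 < η := lt_of_lt_of_le (Real.exp_pos _) hη
  have hτ1 : τ ≤ 1 := by linarith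
  have hτ40 : τ ≤ 1 / 40 := hτc.trans (min_le_left _ _)
  have hC₁τ : 2 * C₁ * τ ^ 4 ≤ 1 := by
    have h1 : τ ≤ 1 / (2 * C₁ + 1) := hτc.trans (min_le_right _ _)
    have h2 : τ ^ 4 ≤ τ := pow_le_of_le_one hτ0.le hτ1 (by norm_num)
    have h3 : 2 * C₁ * τ ≤ 2 * C₁ * (1 / (2 * C₁ + 1)) := mul_le_mul_of_nonneg_left h1 (by positivity)
    have h4 : 2 * C₁ * (1 / (2 * C₁ + 1)) ≤ 1 := by
      rw [mul_one_div, div_le_one (by positivity)]; linarith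
    have h5 : 2 * C₁ * τ ^ 4 ≤ 2 * C₁ * τ := mul_le_mul_of_nonneg_left h2 (by positivity)
    linarith
  have hLτ : 1 / L ≤ τ ^ 5 := by rw [div_le_iff₀ hL0]; linarith
  have hτinvL : 1 / τ ≤ L := by
    rw [div_le_iff₀ hτ0]
    have := mul_le_mul_of_nonneg_left hlogτ hL0.le
    rw [mul_inv_cancel₀ hL0.ne'] at this
    linarith
  have he2 : (2 : ℝ) < Real.exp 1 := by have := Real.exp_one_gt_d9; linarith
  have hXτe : Real.exp 4 ≤ X ^ τ := by
    rw [Real.rpow_def_of_pos hX0, ← hL]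
    exact Real.exp_le_exp.mpr (by nlinarith)
  have he4 : (16 : ℝ) ≤ Real.exp 4 := by
    have h3 : Real.exp 4 = Real.exp 1 ^ 4 := by rw [← Real.exp_nat_mul]; norm_num
    rw [h3]
    calc (16 : ℝ) = 2 ^ 4 := by norm_num
      _ ≤ Real.exp 1 ^ 4 := pow_le_pow_left₀ (by norm_num) he2.le 4
  have hXτ5 : 5 ≤ X ^ τ := by linarith
  have hXτ4 : 4 ≤ X ^ τ := by linarith
  have hCN : (24 : ℝ) < X ^ (3 * τ) := by
    have h1 : Real.exp 12 ≤ X ^ (3 * τ) := by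
      rw [Real.rpow_def_of_pos hX0, ← hL]
      exact Real.exp_le_exp.mpr (by nlinarith)
    have h2 : (24 : ℝ) < Real.exp 12 := by
      have h3 : Real.exp 12 = Real.exp 1 ^ 12 := by rw [← Real.exp_nat_mul]; norm_num
      rw [h3]
      calc (24 : ℝ) < 2 ^ 12 := by norm_num
        _ ≤ Real.exp 1 ^ 12 := pow_le_pow_left₀ (by norm_num) he2.le 12
    linarith
  have hXτ2 : 2 * X ^ τ ≤ X ^ (1 / 2 : ℝ) := by
    have h1 : X ^ (1 / 2 : ℝ) = X ^ τ * X ^ (1 / 2 - τ) := by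
      rw [← Real.rpow_add hX0]; ring_nf
    have h2 : (2 : ℝ) ≤ X ^ (1 / 2 - τ) := by
      have h3 : (16 : ℝ) ^ (1 / 4 : ℝ) = 2 := by
        rw [show (16 : ℝ) = 2 ^ (4 : ℝ) by norm_num, ← Real.rpow_mul (by norm_num)]; norm_num
      calc (2 : ℝ) = 16 ^ (1 / 4 : ℝ) := h3.symm
        _ ≤ X ^ (1 / 4 : ℝ) := Real.rpow_le_rpow (by norm_num) (by linarith) (by norm_num)
        _ ≤ X ^ (1 / 2 - τ) := Real.rpow_le_rpow_of_exponent_le hX1.le (by linarith)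
    rw [h1]
    have h0 : 0 < X ^ τ := Real.rpow_pos_of_pos hX0 τ
    nlinarith
  have h2pow : (2 : ℝ) ^ (4 / τ) ≤ X ^ (τ / 4) := by
    have hτ2L : 12 ≤ τ ^ 2 * L := by
      have : τ ^ 5 ≤ τ ^ 2 := pow_le_pow_of_le_one hτ0.le hτ1 (by norm_num)
      exact h12.trans (mul_le_mul_of_nonneg_right this hL0.le)
    rw [Real.rpow_def_of_pos two_pos, Real.rpow_def_of_pos hX0, ← hL]
    refine Real.exp_le_exp.mpr ?_
    rw [show Real.log 2 * (4 / τ) = (16 * Real.log 2) / (4 * τ) by field_simp; ring,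
      div_le_iff₀ (by positivity)]
    have hl2 := Real.log_two_lt_d9
    nlinarith
  have hE : ∀ xy ∈ E', pairIdeal xy ≠ ⊥ ∧ (Ideal.absNorm (pairIdeal xy) : ℝ) ≤ 24 * X ^ 3 :=
    fun xy hxy => ⟨pairIdeal_ne_bot_of_mem_boxPairs hX0.le xy (hE' hxy),
      (absNorm_pairIdeal_bounds hX0 hη1 (hE' hxy)).2⟩
  have h7A := h7_of_subfamily hE' hX1 hτ0 hCC
    (fun N z 𝒬 hz hN hNX h𝒬 => (h7 X η hX7 hη hη1 N z 𝒬 hz hN hNX h𝒬).1)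
  have hN : ((chainBound τ : ℕ) : ℝ) ≤ 1 / τ + 1 := by
    rw [chainBound]; push_cast
    linarith [Nat.floor_le (by positivity : (0 : ℝ) ≤ 1 / τ)]
  have hsum := U_sum_bound E' pairIdeal hC₁ hwin hX15 hτ0 hτ40 hXτ4 hXτ2 hCN hE hC₇'0
    (M := η ^ 2 * X ^ 2) (by positivity) (Err := X ^ (2 - τ / 5)) (by positivity) h7A hLτ hC₁τ hN
  refine ⟨hX1, hτ0, hτ40, hsum.trans ?_⟩
  clear hsum h7A h7 hE hwin
  have hscale : hbXi τ / τ ^ 4 = τ := hbXi_div_pow_four hτ0.ne'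
  rw [hscale]
  have hXexp : Real.exp L = X := by rw [hL, Real.exp_log hX0]
  have hηX1 : 1 ≤ η * X := by
    have hL3 : L ^ (1 / 3 : ℝ) ≤ L := by
      calc L ^ (1 / 3 : ℝ) ≤ L ^ (1 : ℝ) := Real.rpow_le_rpow_of_exponent_le hL1 (by norm_num)
        _ = L := Real.rpow_one L
    calc (1 : ℝ) = Real.exp 0 := Real.exp_zero.symm
      _ ≤ Real.exp (-L ^ (1 / 3 : ℝ) + L) := Real.exp_le_exp.mpr (by linarith)
      _ = Real.exp (-L ^ (1 / 3 : ℝ)) * Real.exp L := Real.exp_add _ _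
      _ ≤ η * X := by
          rw [hXexp]
          exact mul_le_mul_of_nonneg_right hη hX0.le
  have hη2 : Real.exp (-2 * L ^ (1 / 3 : ℝ)) ≤ η ^ 2 := by
    have : Real.exp (-2 * L ^ (1 / 3 : ℝ)) = Real.exp (-L ^ (1 / 3 : ℝ)) ^ 2 := by
      rw [← Real.exp_nat_mul]; ring_nf
    rw [this]
    exact pow_le_pow_left₀ (Real.exp_pos _).le hη 2
  have habs' : X ^ (-τ / 5) * L ^ 3 ≤ τ * η ^ 2 / L := by
    rw [one_mul] at habs
    refine habs.trans ?_
    exact div_le_div_of_nonneg_right (mul_le_mul_of_nonneg_left hη2 hτ0.le) hL0.le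
  -- the raw terms of `E'` are dominated by those of `𝒜^(K)`
  have hraw : ∀ n ∈ Icc 1 (chainBound τ),
      (∑ t ∈ (Upairs X τ n).filter (fun t => ¬ UGood t), (famCount E' pairIdeal (uIdeal t) : ℝ) +
        ∑ b ∈ (mIndexU τ n).sigma (fun m => Fintype.piFinset fun i => Jprimes X τ (m i)),
          ∑ Q ∈ ((idealsLE (Ideal.absNorm (b.2 (Fin.last n)))).filter
              (fun Q => Q.IsPrime ∧ Q ≠ ⊥ ∧ X ^ ((b.1 (Fin.last n) : ℝ) * hbXi τ) ≤ (Ideal.absNorm Q : ℝ) ∧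
                PrimeLT Q (b.2 (Fin.last n)))).filter
              (fun Q => ¬ ((Ideal.absNorm Q).Prime ∧ ∀ j, Ideal.absNorm Q ≠ Ideal.absNorm (b.2 j))),
            (famCount E' pairIdeal (Q * ∏ j, b.2 j) : ℝ) +
        ∑ b ∈ (mIndexU τ n).sigma (fun m => Fintype.piFinset fun i => Jprimes X τ (m i)),
          (#{i ∈ E' | (∏ j, b.2 j) ∣ pairIdeal i ∧ IsRough (X ^ ((b.1 (Fin.last n) : ℝ) * hbXi τ))
              (pairIdeal i) ∧ ¬ Squarefree (Ideal.absNorm (pairIdeal i) / Ideal.absNorm (∏ j, b.2 j))} : ℝ)) ≤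
      (2 : ℝ) ^ (4 / τ) *
        (3 * (η * X + 1) * ((η * X + 1) * (2 / X ^ τ) + (5 * X ^ (1 - τ / 2) + 1))) := by
    intro n _
    have e1 := E1_A_eq_zero X η τ n
    have e3 := E3ii_A_eq_zero hX1 hτ0 hτ1 η n
    have e4 := E4_A_le hX24 hτ0 hτ1 hη0 hη1 hXτ5 n
    have m1 : ∑ t ∈ (Upairs X τ n).filter (fun t => ¬ UGood t), (famCount E' pairIdeal (uIdeal t) : ℝ) ≤
        ∑ t ∈ (Upairs X τ n).filter (fun t => ¬ UGood t),
          (famCount (boxPairs X η) pairIdeal (uIdeal t) : ℝ) :=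
      sum_le_sum fun t _ => by exact_mod_cast famCount_mono pairIdeal hE' _
    have m3 : ∑ b ∈ (mIndexU τ n).sigma (fun m => Fintype.piFinset fun i => Jprimes X τ (m i)),
          ∑ Q ∈ ((idealsLE (Ideal.absNorm (b.2 (Fin.last n)))).filter
              (fun Q => Q.IsPrime ∧ Q ≠ ⊥ ∧ X ^ ((b.1 (Fin.last n) : ℝ) * hbXi τ) ≤ (Ideal.absNorm Q : ℝ) ∧
                PrimeLT Q (b.2 (Fin.last n)))).filter
              (fun Q => ¬ ((Ideal.absNorm Q).Prime ∧ ∀ j, Ideal.absNorm Q ≠ Ideal.absNorm (b.2 j))),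
            (famCount E' pairIdeal (Q * ∏ j, b.2 j) : ℝ) ≤
        ∑ b ∈ (mIndexU τ n).sigma (fun m => Fintype.piFinset fun i => Jprimes X τ (m i)),
          ∑ Q ∈ ((idealsLE (Ideal.absNorm (b.2 (Fin.last n)))).filter
              (fun Q => Q.IsPrime ∧ Q ≠ ⊥ ∧ X ^ ((b.1 (Fin.last n) : ℝ) * hbXi τ) ≤ (Ideal.absNorm Q : ℝ) ∧
                PrimeLT Q (b.2 (Fin.last n)))).filter
              (fun Q => ¬ ((Ideal.absNorm Q).Prime ∧ ∀ j, Ideal.absNorm Q ≠ Ideal.absNorm (b.2 j))),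
            (famCount (boxPairs X η) pairIdeal (Q * ∏ j, b.2 j) : ℝ) :=
      sum_le_sum fun b _ => sum_le_sum fun Q _ => by exact_mod_cast famCount_mono pairIdeal hE' _
    have m4 : ∑ b ∈ (mIndexU τ n).sigma (fun m => Fintype.piFinset fun i => Jprimes X τ (m i)),
          (#{i ∈ E' | (∏ j, b.2 j) ∣ pairIdeal i ∧ IsRough (X ^ ((b.1 (Fin.last n) : ℝ) * hbXi τ))
              (pairIdeal i) ∧ ¬ Squarefree (Ideal.absNorm (pairIdeal i) / Ideal.absNorm (∏ j, b.2 j))} : ℝ) ≤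
        ∑ b ∈ (mIndexU τ n).sigma (fun m => Fintype.piFinset fun i => Jprimes X τ (m i)),
          (#{xy ∈ boxPairs X η | (∏ j, b.2 j) ∣ pairIdeal xy ∧
              IsRough (X ^ ((b.1 (Fin.last n) : ℝ) * hbXi τ)) (pairIdeal xy) ∧
              ¬ Squarefree (Ideal.absNorm (pairIdeal xy) / Ideal.absNorm (∏ j, b.2 j))} : ℝ) :=
      sum_le_sum fun b _ => by exact_mod_cast card_le_card (filter_subset_filter _ hE')
    linarith [m1, m3, m4, e1, e3, e4]
  calc _ ≤ ∑ n ∈ Icc 1 (chainBound τ), (2 : ℝ) ^ (4 / τ) *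
          (3 * (η * X + 1) * ((η * X + 1) * (2 / X ^ τ) + (5 * X ^ (1 - τ / 2) + 1))) +
        C₇' * (η ^ 2 * X ^ 2 / (τ * L)) * ((1600 + 700 * C₁) * τ ^ 2) +
        70 * (1 / τ + 1) * L * (C₇' * X ^ (2 - τ / 5)) := by
        gcongr with n hn
        exact hraw n hn
    _ = (chainBound τ : ℝ) * ((2 : ℝ) ^ (4 / τ) *
          (3 * (η * X + 1) * ((η * X + 1) * (2 / X ^ τ) + (5 * X ^ (1 - τ / 2) + 1)))) +
        C₇' * (η ^ 2 * X ^ 2 / (τ * L)) * ((1600 + 700 * C₁) * τ ^ 2) +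
        70 * (1 / τ + 1) * L * (C₇' * X ^ (2 - τ / 5)) := by
        rw [sum_const, Nat.card_Icc, Nat.add_sub_cancel, nsmul_eq_mul]
    _ ≤ (C₇' * (1600 + 700 * C₁) + 140 * C₇' + 120) * τ * (η ^ 2 * X ^ 2 / L) :=
        A_final_absorb hX1 hL1 hτ0 hτ1 hη0 hη1 hC₇'0 hC₁ hηX1 hXτ5 h2pow hτinvL hN habs'

end Literature.NumberTheory.Sieve.CubicSieve

end
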